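import Summits.BirchSwinnertonDyer.BirchSwinnertonDyer.Theorems.ResidualThetaTransportAtTwoResidualSignedLambdaLowerCMAtTwoPairingSumPlusValue
import Summits.BirchSwinnertonDyer.BirchSwinnertonDyer.Theorems.ResidualThetaTransportAtTwoResidualThetaMainConjectureAtTwoLimitFree
import Summits.BirchSwinnertonDyer.BirchSwinnertonDyer.Theorems.ResidualThetaTransportAtTwoLambdaLowerBoundO
import HarnessLib

/-!
# The PLUS Coleman VALUE with coefficients: for an `𝒪`-valued trace-compatible family (`𝒪` finite free over `ℤ_p`, e.g.
# `𝒪 = padicCoeffIntegers S`) there is `L ∈ 𝒪⟦T⟧` with `Q_{2m}(a_{2m}) ≡ (−1)^m ω⁻_{2m}·L (mod ω_{2m})` for ALL `m`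

Route `ResidualThetaTransportAtTwo` (RTT), crux RSL_g `ResidualSignedLambdaLowerCMAtTwo` (stmt-BirchSwinnertonDyer-22608): DAG node N1 ⊗ 𝒪
(`RSLG-LINE-DAG-g14.md`) = the ONE `⊗𝒪` lemma of STUB-PLAN rev 4 §3.2 `stub_colemanValueIndex` (T1) / k3-g3 H2
`exists_plusValue_orbitSum_coeff` (`Cruxes/ResidualThetaCountLowerPureAtTwo/Sketch_sidea_k3_g3.lean`, there a sorried SIGNATURE).
Seat `prover-bsd-wall-rtt-p2` g15 (`--supports`, closes nothing). Sequel of `…PairingSumPlusValue` (p655747, the case `𝒪 = ℤ_p`).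
THEOREMS ONLY; polynomial algebra; nothing about any Selmer group or `L`-function; valid for every prime; BSD is not proved by any of this.

## What
* §1 `X_mul_cyclotomicOmegaPlus_dvd_add_of_isDomain` — the compatibility `X·ω⁺_{2m} ∣ u_{m+1} + u_m` of the quotients
  `u_m = Q_{2m}/ω⁻_{2m}` over ANY domain `R` (p655747 stated it over `ℤ_p`; same proof).
* §2 **`exists_plusValue_orbitSum_coeff`** — for `𝒪` a domain, finite free over `ℤ_p`, and `a : ℕ → ℕ → 𝒪` with `a n` `pⁿ`-periodic and
  the trace relation `∑_{s<p} a (n+2) (r + p^{n+1}s) = −a n r`: `∃ L ∈ 𝒪⟦T⟧, ∀ m, ω_{2m} ∣ Q_{2m}(a_{2m}) − (−1)^m·ω⁻_{2m}·L`.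
  Proof = p655747's with Lang's gluing over `𝒪` (`ResidualThetaLayer.exists_powerSeries_sub_eq_mul_of_free`, tree: coordinates in a
  `ℤ_p`-basis of `𝒪`).
* §3 **`exists_plusValue_orbitSum_padicCoeffIntegers`** — the same VERBATIM on the crux's carriers `𝒪 = padicCoeffIntegers S`,
  `Λ_𝒪 = IwasawaAlgebraO S` (`ℚ_p(S)/ℚ_p` finite) = k3-g3 H2's signature.
* §4 **`exists_plusValue_addMonoidHom_coeff`** — bridge for an `𝒪`-VALUED functional `z : A →+ 𝒪` on Sprung's data (`A`, `g`, family `c`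
  with `g^{pⁿ}•c n = c n`, `∑_{s<p} g^{p^{n+1}s}•c (n+2) = −c n`, orbits in `A`): the family `a n j := z(gʲ•c n)` qualifies, so the plus
  Coleman value `Col⁺(z) ∈ 𝒪⟦T⟧` exists — for `z` = Θ-transport of `loc₂` of Kato's class of `g` this is `Col⁺_g(loc₂ z_g)`.

References: [Kobayashi2003] Cor. 8.20, Prop. 8.21, Def. 8.22 (pp. 21–22); [Lang1990] Ch. 5 §1 Thm. 1.1; [Pollack2003] §6.5;
[Sprung2012] Def. 5.9.
-/

set_option autoImplicit false
-- the Theorems namespace of this sub repeats the summit name by design (D-0017 nested layout)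
set_option linter.dupNamespace false

noncomputable section

open scoped Classical
open Polynomial Finset

namespace Summit.BirchSwinnertonDyer.BirchSwinnertonDyer.Theorems.SignedColemanImage

open Literature.NumberTheory.EllipticCurves

/-! ## §1 Compatibility of the quotients over any domain -/

section Domain

variable {R : Type*} [CommRing R] [IsDomain R] {p : ℕ} [Fact p.Prime]

/-- **Compatibility** over any domain `R`: for orbit polynomials of a trace-compatible coefficient family `a : ℕ → ℕ → R`, the quotients
`u_m := Q_{2m}/ω⁻_{2m}` satisfy `X·ω⁺_{2m} ∣ u_{m+1} + u_m` in `R[X]` (p655747's `X_mul_cyclotomicOmegaPlus_dvd_add` is the case `R = ℤ_p`).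
[cite: Kobayashi2003, Prop. 8.21 (8.27) (pp. 21–22)] -/
theorem X_mul_cyclotomicOmegaPlus_dvd_add_of_isDomain (a : ℕ → ℕ → R)
    (hper : ∀ n t, a n (t + p ^ n) = a n t)
    (htr : ∀ n r, ∑ s ∈ range p, a (n + 2) (r + p ^ (n + 1) * s) = -a n r) (m : ℕ) (u u' : R[X])
    (hu : ∑ j ∈ range (p ^ (2 * m)), C (a (2 * m) j) * (X + 1) ^ j = (cyclotomicOmegaMinus p (2 * m)).map (Int.castRingHom R) * u)
    (hu' : ∑ j ∈ range (p ^ (2 * m + 2)), C (a (2 * m + 2) j) * (X + 1) ^ j =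
      (cyclotomicOmegaMinus p (2 * m + 2)).map (Int.castRingHom R) * u') :
    (X * cyclotomicOmegaPlus p (2 * m)).map (Int.castRingHom R) ∣ u' + u := by
  have hp : p.Prime := Fact.out
  have h3 := cyclotomicOmega_dvd_orbitSum_add hp (2 * m) (a (2 * m + 2)) (a (2 * m)) (hper (2 * m)) (htr (2 * m))
  rw [show 2 * m + 1 = 2 * m + 1 from rfl, hu', hu] at h3
  have h4 : (cyclotomicOmega p (2 * m + 1)).map (Int.castRingHom R) ∣
      (cyclotomicOmegaMinus p (2 * m + 2)).map (Int.castRingHom R) * (u' + u) := by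
    have e : (cyclotomicOmegaMinus p (2 * m + 2)).map (Int.castRingHom R) * (u' + u) =
        (cyclotomicOmegaMinus p (2 * m + 2)).map (Int.castRingHom R) * u' +
          ((cyclotomic (p ^ (2 * m + 1)) ℤ).comp (X + 1)).map (Int.castRingHom R) *
            ((cyclotomicOmegaMinus p (2 * m)).map (Int.castRingHom R) * u) := by
      rw [mul_add, cyclotomicOmegaMinus_two_mul_add_two, Polynomial.map_mul]; ring
    rw [e]; exact h3
  rw [cyclotomicOmega_two_mul_add_one_eq, Polynomial.map_mul, mul_comm] at h4
  have hne : (cyclotomicOmegaMinus p (2 * m + 2)).map (Int.castRingHom R) ≠ 0 :=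
    ((monic_cyclotomicOmegaMinus p (2 * m + 2)).map _).ne_zero
  exact (mul_dvd_mul_iff_left hne).mp h4

end Domain

/-! ## §2 The plus value over a coefficient ring `𝒪` finite free over `ℤ_p` -/

section Coeff

variable {p : ℕ} [Fact p.Prime] {O : Type*} [CommRing O] [IsDomain O] [Algebra ℤ_[p] O] [Module.Free ℤ_[p] O]
  [Module.Finite ℤ_[p] O]

omit [Fact p.Prime] [IsDomain O] [Module.Free ℤ_[p] O] [Module.Finite ℤ_[p] O] in
/-- `Int.castRingHom 𝒪` factors through `ℤ_p` (uniqueness of ring maps from `ℤ`). [folklore] -/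
theorem algebraMap_comp_intCastRingHom (p : ℕ) [Fact p.Prime] [Algebra ℤ_[p] O] :
    (algebraMap ℤ_[p] O).comp (Int.castRingHom ℤ_[p]) = Int.castRingHom O :=
  RingHom.ext_int _ _

/-- **The plus value of an `𝒪`-valued orbit family exists** (k3-g3 H2; the `⊗𝒪` of p655747's `exists_plusValue_orbitSum`): for `𝒪` a domain,
finite free over `ℤ_p`, and `a : ℕ → ℕ → 𝒪` with `a n` `pⁿ`-periodic and the trace relation, there is `L ∈ 𝒪⟦T⟧` with
`ω_{2m} ∣ Q_{2m}(a_{2m}) − (−1)^m·ω⁻_{2m}·L` for every `m`. The gluing is Lang's, over `𝒪` (tree `ResidualThetaLayer.exists_powerSeries_sub_eq_mul_of_free`,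
by coordinates in a `ℤ_p`-basis — this is where finite freeness over `ℤ_p`, i.e. `(p,T)`-adic completeness of `𝒪⟦T⟧`, enters).
[cite: Kobayashi2003, Cor. 8.20, Prop. 8.21 and Def. 8.22 (pp. 21–22)] [cite: Lang1990, Ch. 5 §1 Thm. 1.1] -/
theorem exists_plusValue_orbitSum_coeff (a : ℕ → ℕ → O)
    (hper : ∀ n t, a n (t + p ^ n) = a n t)
    (htr : ∀ n r, ∑ s ∈ range p, a (n + 2) (r + p ^ (n + 1) * s) = -a n r) :
    ∃ L : PowerSeries O, ∀ m : ℕ,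
      (((cyclotomicOmega p (2 * m)).map (Int.castRingHom O) : O[X]) : PowerSeries O) ∣
        ((∑ j ∈ range (p ^ (2 * m)), C (a (2 * m) j) * (X + 1) ^ j : O[X]) : PowerSeries O) -
          (-1 : PowerSeries O) ^ m * ((((cyclotomicOmegaMinus p (2 * m)).map (Int.castRingHom O) : O[X]) :
            PowerSeries O) * L) := by
  -- the quotients `u m`
  choose u hu using fun m ↦ cyclotomicOmegaMinus_dvd_orbitSum (R := O) a hper htr m
  -- compatibility witnesses `t m`: `u (m+1) + u m = X ω⁺_{2m} · t m`
  choose t ht using fun m ↦ X_mul_cyclotomicOmegaPlus_dvd_add_of_isDomain a hper htr m (u m) (u (m + 1)) (hu m)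
    (by rw [show 2 * m + 2 = 2 * (m + 1) by ring]; exact hu (m + 1))
  -- gluing data (over `ℤ_p`)
  set ξ : ℕ → ℤ_[p][X] := fun i ↦ ((cyclotomic (p ^ (2 * i + 2)) ℤ).comp (X + 1)).map (Int.castRingHom ℤ_[p]) with hξ
  have hξp : ∀ i, (p : ℤ_[p]) ∣ (ξ i).coeff 0 := fun i ↦ by
    show (p : ℤ_[p]) ∣ (((cyclotomic (p ^ (2 * i + 2)) ℤ).comp (X + 1)).map (Int.castRingHom ℤ_[p])).coeff 0
    rw [show 2 * i + 2 = (2 * i + 1) + 1 by ring]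
    exact prime_dvd_coeff_zero_cyclotomic_comp (2 * i + 1)
  have hprod : ∀ M, ((X : ℤ_[p][X]) * ∏ i ∈ range M, ξ i).map (algebraMap ℤ_[p] O) =
      (X * cyclotomicOmegaPlus p (2 * M)).map (Int.castRingHom O) := by
    intro M
    have h1 : (X : ℤ_[p][X]) * ∏ i ∈ range M, ξ i = (X * cyclotomicOmegaPlus p (2 * M)).map (Int.castRingHom ℤ_[p]) := by
      rw [Polynomial.map_mul, Polynomial.map_X, cyclotomicOmegaPlus_two_mul_eq_prod, Polynomial.map_prod]
    rw [h1, Polynomial.map_map, algebraMap_comp_intCastRingHom (O := O) p]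
  set g : ℕ → O[X] := fun M ↦ C ((-1 : O) ^ M) * u M with hg
  have hgstep : ∀ M, g (M + 1) - g M =
      ((X : ℤ_[p][X]) * ∏ i ∈ range M, ξ i).map (algebraMap ℤ_[p] O) * (C ((-1 : O) ^ (M + 1)) * t M) := by
    intro M
    rw [hprod M, mul_left_comm, ← ht M, hg]
    simp only [pow_succ, map_mul, map_neg, map_one]
    ring
  obtain ⟨L, hL⟩ := ResidualThetaLayer.exists_powerSeries_sub_eq_mul_of_free X ξ hξp g
    (fun M ↦ C ((-1 : O) ^ (M + 1)) * t M) hgstep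
  refine ⟨L, fun m ↦ ?_⟩
  obtain ⟨Q, hQ⟩ := hL m
  rw [hprod m] at hQ
  -- `Q_{2m} = ω⁻ u_m` and `(−1)^m g_m = u_m`
  have hgm : (-1 : PowerSeries O) ^ m * ((g m : O[X]) : PowerSeries O) = (u m : PowerSeries O) := by
    rw [hg]
    simp only
    rw [Polynomial.coe_mul, Polynomial.coe_C, map_pow, map_neg, map_one, ← mul_assoc, ← pow_add, ← two_mul, pow_mul]
    norm_num
  rw [hu m, Polynomial.coe_mul]
  have key : (((cyclotomicOmegaMinus p (2 * m)).map (Int.castRingHom O) : O[X]) : PowerSeries O) * (u m : PowerSeries O) -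
      (-1 : PowerSeries O) ^ m * ((((cyclotomicOmegaMinus p (2 * m)).map (Int.castRingHom O) : O[X]) : PowerSeries O) * L) =
      -((-1 : PowerSeries O) ^ m * ((((cyclotomicOmegaMinus p (2 * m)).map (Int.castRingHom O) : O[X]) : PowerSeries O) *
        (L - (g m : PowerSeries O)))) := by
    rw [← hgm]
    ring
  rw [key, hQ, ← mul_assoc (((cyclotomicOmegaMinus p (2 * m)).map (Int.castRingHom O) : O[X]) : PowerSeries O)]
  refine dvd_neg.mpr (Dvd.dvd.mul_left (Dvd.dvd.mul_right ?_ _) _)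
  rw [← Polynomial.coe_mul, ← Polynomial.map_mul, mul_comm (cyclotomicOmegaMinus p (2 * m)),
    X_mul_cyclotomicOmegaPlus_mul_cyclotomicOmegaMinus]

end Coeff

/-! ## §3 On the crux's carriers `𝒪 = padicCoeffIntegers S`, `Λ_𝒪 = IwasawaAlgebraO S` -/

section CruxCurrency

open Literature.NumberTheory.Automorphic

variable {p : ℕ} [Fact p.Prime] (S : Set (PadicAlgCl p))

/-- **k3-g3 H2 verbatim** (`Sketch_sidea_k3_g3.lean`, `exists_plusValue_orbitSum_coeff`): the plus value of a trace-compatible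
`𝒪`-valued family exists in `Λ_𝒪 = IwasawaAlgebraO S`, `𝒪 = padicCoeffIntegers S` the integers of a FINITE `ℚ_p(S)/ℚ_p`
(finite free over `ℤ_p`: `PadicIntermediateField.moduleFree_unitBall` / `moduleFinite_unitBall` along `padicCoeffIntegers_eq_unitBall`).
[cite: Kobayashi2003, Cor. 8.20, Prop. 8.21 and Def. 8.22 (pp. 21–22)] [cite: Lang1990, Ch. 5 §1 Thm. 1.1] -/
theorem exists_plusValue_orbitSum_padicCoeffIntegers [FiniteDimensional ℚ_[p] (padicCoeffField S)] :
    ∀ (a : ℕ → ℕ → padicCoeffIntegers S),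
      (∀ n t, a n (t + p ^ n) = a n t) →
      (∀ n r, ∑ s ∈ range p, a (n + 2) (r + p ^ (n + 1) * s) = -a n r) →
      ∃ L : IwasawaAlgebraO S, ∀ m : ℕ,
        (((cyclotomicOmega p (2 * m)).map (Int.castRingHom (padicCoeffIntegers S)) : (padicCoeffIntegers S)[X]) :
            IwasawaAlgebraO S) ∣
          ((∑ j ∈ range (p ^ (2 * m)), Polynomial.C (a (2 * m) j) * (Polynomial.X + 1) ^ j :
              (padicCoeffIntegers S)[X]) : IwasawaAlgebraO S) -
            (-1 : IwasawaAlgebraO S) ^ m *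
              ((((cyclotomicOmegaMinus p (2 * m)).map (Int.castRingHom (padicCoeffIntegers S)) :
                  (padicCoeffIntegers S)[X]) : IwasawaAlgebraO S) * L) := by
  unfold IwasawaAlgebraO
  rw [padicCoeffIntegers_eq_unitBall S]
  intro a hper htr
  exact exists_plusValue_orbitSum_coeff a hper htr

end CruxCurrency

/-! ## §4 Bridge: the plus Coleman value of an `𝒪`-valued functional on Sprung's data -/

section Functional

universe u

variable {K : Type u} [Field K] {p : ℕ} [Fact p.Prime]
variable {E : Type u} [Field E] [Algebra K E] (W : WeierstrassCurve K)
variable {O : Type*} [CommRing O] [IsDomain O] [Algebra ℤ_[p] O] [Module.Free ℤ_[p] O] [Module.Finite ℤ_[p] O]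

omit [Fact p.Prime] [IsDomain O] [Algebra ℤ_[p] O] [Module.Free ℤ_[p] O] [Module.Finite ℤ_[p] O] in
/-- The orbit family `a n j := z(gʲ • c n)` of an additive functional `z : A →+ 𝒪` on Sprung's data is `pⁿ`-periodic and satisfies the
trace relation (`𝒪`-valued twin of p654585's `orbitCoeff_periodic_and_trace`). [cite: Sprung2012, Def. 3.1, Def. 5.9 (pp. 1491, 1495)] -/
theorem orbitCoeff_periodic_and_trace_addMonoidHom (A : AddSubgroup (localPoints W E)) (g : Field.absoluteGaloisGroup E)
    (c : ℕ → localPoints W E) (hA : ∀ n j, g ^ j • c n ∈ A) (hfix : ∀ n, g ^ p ^ n • c n = c n)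
    (htr : ∀ n, ∑ s ∈ range p, g ^ (p ^ (n + 1) * s) • c (n + 2) = -c n) (z : A →+ O) :
    (∀ n t, z ⟨g ^ (t + p ^ n) • c n, hA n _⟩ = z ⟨g ^ t • c n, hA n t⟩) ∧
      ∀ n r, ∑ s ∈ range p, z ⟨g ^ (r + p ^ (n + 1) * s) • c (n + 2), hA (n + 2) _⟩ = -z ⟨g ^ r • c n, hA n r⟩ := by
  refine ⟨fun n t ↦ congrArg z (Subtype.ext (by simp only [pow_add, mul_smul, hfix])), fun n r ↦ ?_⟩
  have hsum_pt : ∑ s ∈ range p, g ^ (r + p ^ (n + 1) * s) • c (n + 2) = -(g ^ r • c n) := by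
    rw [← smul_neg, ← htr n, smul_sum]
    exact sum_congr rfl fun s _ ↦ by rw [← mul_smul, ← pow_add]
  rw [← map_neg, ← map_sum]
  congr 1
  apply Subtype.ext
  rw [AddSubmonoidClass.coe_finsetSum, NegMemClass.coe_neg]
  exact hsum_pt

/-- **Every `𝒪`-valued functional has a plus Coleman value** (any prime `p`; `𝒪` a domain finite free over `ℤ_p`): for Sprung's data
`A`, `g`, `c` (`g^{pⁿ} • c n = c n`, `∑_{s<p} g^{p^{n+1}s} • c (n+2) = −c n`, orbits in `A`) and every `z : A →+ 𝒪` there is `L ∈ 𝒪⟦T⟧` with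
`ω_{2m} ∣ Q_{2m}(z(g^• • c_{2m})) − (−1)^m·ω⁻_{2m}·L` for ALL `m` — the plus Coleman value `Col⁺(z)` with coefficients (for the Θ-transport of
`loc₂` of Kato's class of the CM form `g`: `Col⁺_g(loc₂ z_g)`). [cite: Kobayashi2003, Cor. 8.20, Prop. 8.21, Def. 8.22 (pp. 21–22)]
[cite: Sprung2012, Def. 5.9 (p. 1495)] -/
theorem exists_plusValue_addMonoidHom_coeff (A : AddSubgroup (localPoints W E)) (g : Field.absoluteGaloisGroup E)
    (c : ℕ → localPoints W E) (hA : ∀ n j, g ^ j • c n ∈ A) (hfix : ∀ n, g ^ p ^ n • c n = c n)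
    (htr : ∀ n, ∑ s ∈ range p, g ^ (p ^ (n + 1) * s) • c (n + 2) = -c n) (z : A →+ O) :
    ∃ L : PowerSeries O, ∀ m : ℕ,
      (((cyclotomicOmega p (2 * m)).map (Int.castRingHom O) : O[X]) : PowerSeries O) ∣
        ((∑ j ∈ range (p ^ (2 * m)), C (z ⟨g ^ j • c (2 * m), hA (2 * m) j⟩) * (X + 1) ^ j : O[X]) : PowerSeries O) -
          (-1 : PowerSeries O) ^ m * ((((cyclotomicOmegaMinus p (2 * m)).map (Int.castRingHom O) : O[X]) :
            PowerSeries O) * L) := by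
  obtain ⟨hper, htr'⟩ := orbitCoeff_periodic_and_trace_addMonoidHom W A g c hA hfix htr z
  exact exists_plusValue_orbitSum_coeff (fun n j ↦ z ⟨g ^ j • c n, hA n j⟩) hper htr'

end Functional

end Summit.BirchSwinnertonDyer.BirchSwinnertonDyer.Theorems.SignedColemanImage

end
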